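import Mathlib
import Summits.Ventures.HodgeRepro.Tier4.Target
import Summits.Ventures.HodgeRepro.Tier4.Line3.Defs
import Summits.Ventures.HodgeRepro.Tier4.Line3.DefsLemmas
import Summits.Ventures.HodgeRepro.Tier4.Line3.LocaliserS
import Summits.Ventures.HodgeRepro.Tier4.Line3.MainClassReps
import Summits.Ventures.HodgeRepro.Tier4.Line3.GoodSplitBracket
import Summits.Ventures.HodgeRepro.Tier4.Line3.BadPlaceBracket

/-!
# Tier4/Line3/PosOfFactorisation — termwise positivity of the localised coefficients on the main orbit, FROM the displayed
local factorisation (the reduction of L3's residual `hP` to ONE named hypothesis)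

Blind re-derivation cell `pub-hodge-repro`, Tier 4 «PROVE THE STEP» (README §9–§10), LINE L3, seat t4-L3-p1 (g2), wall-breaker
support for the line's residual `hP : X.IsHeckeLocalisableP D` (Skeleton v0.31 `P_of_line_pos`; the retracted wall
`pos_localiser` of v0.29 L490, CENSUS-v0.29.md §1).  SUPPORT: consumed by no filed statement; `LocPS` / `IsHeckeLocalisableP`
stay the skeleton's (the clause `LocPS.pos` is restated here verbatim as the conclusion, so the skeleton can build `LocPS` from it
by name).

## What is displayed

`LocalFactorisation D p L₀ xm ℓ` is the UNPRINTED STEP of the wall's paper proof (CENSUS-v0.29 §1, «FACTORISATION»; t4-lit-2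
S12743 / t4-lit-4 S12742: not printed in the form the wall needs), as data: a finite set `bad` of places (`𝔭`, the places where
`X.H` or the Gram entries of `xm` are not units, the conductors), per place the slot-character values (`u w j = μ_{j,w}(ϖ_w)` at a
good split place; `μ w j : (X.E)ˣ →* ℂ` on the global proxies at a bad place), volumes `vol w`, depths `n w`, the unit conditions
at the good places, and THE IDENTITY: from some depth `N₀` on, at every main class `c` of the level,
`coefQ D.cf (ℓ.loc N) (mainRep c) = A · ∏_{w ∈ T} B_w(mainRep c 0, mainRep c 1)` with `A ≥ 0` real (the archimedean and definite
factors), `T` a finite set of places, `B_w` the GOOD-SPLIT bracket (`GoodSplit.bracket`, `Tier4/Line3/GoodSplitBracket`) at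
`w ∉ bad` and the BAD-PLACE bracket (`BadPlace.bracket` on the split model, `Tier4/Line3/BadPlaceBracket`) at `w ∈ bad`.
Nothing else is assumed about `coefQ`.

## What is proved

`pos_of_localFactorisation`: under the displayed factorisation, the face identity `ε_w(ϖ_w) = 1` at every good split place
(`hε_good`) and, at every bad place, the CONDUCTOR conditions of `BadPlace.bracket_nonneg_of_valuation` (`BadConditions`:
depth `n w` beyond the contents of `xm 0`, `xm 1`, the valuation `e` of `H(xm 0, xm 1)`, triviality of the slot characters on
`v(t − 1) ≤ ofAdd(m − n)` and of `μ₁μ̄₃` on `v(t − 1) ≤ ofAdd(e − n)`, the face identity `ε ≡ 1` on the torus), the clause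
`LocPS.pos` holds: `∃ N₀, ∀ N ≥ N₀, ∀ c, (coefQ D.cf (ℓ.loc N) (mainRep c)).im = 0 ∧ 0 ≤ (…).re`.  THE POINT OF THE MAIN ORBIT:
every representative `mainRep c = gRep c • xm` has the SAME Gram entries as `xm` (`hform_unitary`, `gRep_isUnitaryOf`), so the
unit conditions — hence the single-term shape of the good-split brackets — hold at every class, uniformly in the level.

## What this buys

L3's residual at CLOSE reads «`LocalFactorisation` for the natural localiser, with `hε` at every place» — the unprinted
factorisation as ONE named hypothesis; the bookkeeping (i)/(iii) of CENSUS-v0.29 §1 is kernel-checked.  O-L3-7 lives exactly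
in `hε_good` / the face identity of `BadConditions` (false on the twisted members, TWIST-REFUTATION-CHECK.md).  Nothing here
asserts anything about the truth of (P); HC_CM is NOT proved by anyone in this repository.
-/

set_option autoImplicit false

noncomputable section

namespace Summit.Ventures.HodgeRepro.Tier4.Line3

open Summit.Ventures.HodgeRepro.Tier4
open Matrix
open scoped ComplexConjugate WithZero

open scoped Classical

/-- A finite product of complex numbers that are non-negative reals is a non-negative real. -/
theorem prod_im_eq_zero_re_nonneg {ι : Type*} (s : Finset ι) (f : ι → ℂ)
    (hf : ∀ i ∈ s, (f i).im = 0 ∧ 0 ≤ (f i).re) : (∏ i ∈ s, f i).im = 0 ∧ 0 ≤ (∏ i ∈ s, f i).re := by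
  induction s using Finset.induction_on with
  | empty => simp
  | insert a s ha ih =>
    rw [Finset.prod_insert ha]
    have h1 := hf a (Finset.mem_insert_self a s)
    have h2 := ih (fun i hi => hf i (Finset.mem_insert_of_mem hi))
    constructor
    · rw [Complex.mul_im, h1.1, h2.1]
      ring
    · rw [Complex.mul_re, h1.1, h2.1]
      simp only [mul_zero, sub_zero]
      exact mul_nonneg h1.2 h2.2

namespace T4Data

variable (X : T4Data)

/-- The bad-place bracket of the line at `w`, depth `n`, around the symmetric centre `(xm 0, xm 1)`, slot characters `μ` on the
global proxies and volume `vol`, evaluated at the split-model points of the representative `x`. -/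
def badBracket (w : IsDedekindDomain.HeightOneSpectrum (NumberField.RingOfIntegers X.E)) (μ : Fin 4 → (X.E)ˣ →* ℂ)
    (n : ℕ) (xm x : X.Tuple) (vol : ℝ) : ℂ :=
  BadPlace.bracket BadPlace.splitAct μ
    ![BadPlace.Ball (w.valuation X.E) X.c n (xm 0), BadPlace.Ball (w.valuation X.E) X.c n (xm 1),
      BadPlace.Ball (w.valuation X.E) X.c n (xm 0), BadPlace.Ball (w.valuation X.E) X.c n (xm 1)] vol
    (BadPlace.ι X.c (x 0)) (BadPlace.ι X.c (x 1))

/-- The good-split bracket of the line at `w`, slot values `u`, volume `vol`, at the representative `x`. -/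
def goodBracket (w : IsDedekindDomain.HeightOneSpectrum (NumberField.RingOfIntegers X.E)) (u : Fin 4 → ℂ) (vol : ℝ)
    (x : X.Tuple) : ℂ :=
  GoodSplit.bracket (w.valuation X.E) X.c u vol (x 0) (x 1)

/-- **THE LOCAL FACTORISATION of the localised coefficient system on the main orbit — the unprinted step of the wall,
DISPLAYED as data.**  From depth `N₀` on, at every main class `c` of the level `ℓ.level N`, the coefficient
`coefQ D.cf (ℓ.loc N) (mainRep c)` is a non-negative real times a finite product of local brackets at the representative:
the good-split bracket (`GoodSplitBracket`) at the places outside `bad`, the bad-place bracket (`BadPlaceBracket`, split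
model, depth `n w`) at the places of `bad`.  The good places carry the unit conditions of the natural localiser (`H` integral,
`H(xm 0, xm 0)`, `H(xm 1, xm 1)` units at `w`, `H(xm 0, xm 1)` a unit at `w` and at `w̄`). -/
structure LocalFactorisation (D : X.ThetaData)
    (p : IsDedekindDomain.HeightOneSpectrum (NumberField.RingOfIntegers X.E))
    (L₀ : Submodule (NumberField.RingOfIntegers X.E) (Fin 3 → X.E)) (xm : X.Tuple) (ℓ : X.LocS D p L₀ xm) where
  /-- the bad places -/
  bad : Finset (IsDedekindDomain.HeightOneSpectrum (NumberField.RingOfIntegers X.E))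
  /-- the slot-character values `μ_{j,w}(ϖ_w)` at the good split places -/
  u : IsDedekindDomain.HeightOneSpectrum (NumberField.RingOfIntegers X.E) → Fin 4 → ℂ
  /-- the local volumes -/
  vol : IsDedekindDomain.HeightOneSpectrum (NumberField.RingOfIntegers X.E) → ℝ
  /-- the slot characters on the global proxies at the bad places -/
  μ : IsDedekindDomain.HeightOneSpectrum (NumberField.RingOfIntegers X.E) → Fin 4 → (X.E)ˣ →* ℂ
  /-- the depth of the slot balls at the bad places -/
  n : IsDedekindDomain.HeightOneSpectrum (NumberField.RingOfIntegers X.E) → ℕ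
  /-- `H` is integral at every good place -/
  good_integral : ∀ w ∉ bad, ∀ i j, w.valuation X.E (X.H i j) ≤ 1
  /-- the Gram entries of the symmetric centre are units at every good place (at `w` and at `w̄`) -/
  good_unit : ∀ w ∉ bad,
    w.valuation X.E (hform X.c X.H (xm 0) (xm 0)) = 1 ∧ w.valuation X.E (hform X.c X.H (xm 1) (xm 1)) = 1 ∧
    w.valuation X.E (hform X.c X.H (xm 0) (xm 1)) = 1 ∧ w.valuation X.E (hform X.c X.H (xm 1) (xm 0)) = 1
  /-- the depth from which the identity holds -/
  N₀ : ℕ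
  /-- THE IDENTITY: coefficient = non-negative real × finite product of local brackets at the representative -/
  factor : ∀ N, N₀ ≤ N → ∀ c : X.MainClass (ℓ.level N) xm,
    ∃ (A : ℝ) (T : Finset (IsDedekindDomain.HeightOneSpectrum (NumberField.RingOfIntegers X.E))), 0 ≤ A ∧
      X.coefQ D.cf (ℓ.loc N) (X.mainRep (ℓ.level N) xm c) = (A : ℂ) * ∏ w ∈ T,
        (if w ∈ bad then X.badBracket w (μ w) (n w) xm (X.mainRep (ℓ.level N) xm c) (vol w)
         else X.goodBracket w (u w) (vol w) (X.mainRep (ℓ.level N) xm c))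

namespace LocalFactorisation

variable {X} {D : X.ThetaData} {p : IsDedekindDomain.HeightOneSpectrum (NumberField.RingOfIntegers X.E)}
  {L₀ : Submodule (NumberField.RingOfIntegers X.E) (Fin 3 → X.E)} {xm : X.Tuple} {ℓ : X.LocS D p L₀ xm}

/-- **THE CONDITIONS AT A BAD PLACE** (crit-2 S12745 (E): the depth `n w` is chosen after `xm` and the characters):
`H` and the centre integral at `w`, contents `m_a`, `m_b` of `xm 0`, `xm 1` and the valuation `e` of `H(xm 0, xm 1)` with
`n w > m_a, m_b`, the slot characters trivial on `v(t − 1) ≤ ofAdd(m − n)`, `μ₁ μ̄₃` trivial on `v(t − 1) ≤ ofAdd(e − n)`, and the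
face identity `ε ≡ 1` on the torus. -/
def BadConditions (F : X.LocalFactorisation D p L₀ xm ℓ)
    (w : IsDedekindDomain.HeightOneSpectrum (NumberField.RingOfIntegers X.E)) : Prop :=
  (∀ i j, w.valuation X.E (X.H i j) ≤ 1) ∧ (∀ i, w.valuation X.E (X.c (xm 0 i)) ≤ 1) ∧
  (∀ j, w.valuation X.E (xm 1 j) ≤ 1) ∧
  ∃ (i₀ j₀ : Fin 3) (ma mb e : ℤ),
    w.valuation X.E (xm 0 i₀) = ↑(Multiplicative.ofAdd (-ma)) ∧ w.valuation X.E (xm 1 j₀) = ↑(Multiplicative.ofAdd (-mb)) ∧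
    ma < F.n w ∧ mb < F.n w ∧ w.valuation X.E (hform X.c X.H (xm 0) (xm 1)) = ↑(Multiplicative.ofAdd (-e)) ∧
    (∀ j : Fin 4, ∀ t : (X.E)ˣ, w.valuation X.E ((t : X.E) - 1) ≤ ↑(Multiplicative.ofAdd (ma - F.n w)) → F.μ w j t = 1) ∧
    (∀ j : Fin 4, ∀ t : (X.E)ˣ, w.valuation X.E ((t : X.E) - 1) ≤ ↑(Multiplicative.ofAdd (mb - F.n w)) → F.μ w j t = 1) ∧
    (∀ t : (X.E)ˣ, w.valuation X.E ((t : X.E) - 1) ≤ ↑(Multiplicative.ofAdd (e - F.n w)) →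
      F.μ w 1 t * conj (F.μ w 3 t) = 1) ∧
    (∀ t : (X.E)ˣ, F.μ w 0 t * F.μ w 1 t * conj (F.μ w 2 t) * conj (F.μ w 3 t) = 1)

end LocalFactorisation

/-- The Gram entries of a main-class representative are those of `xm` (`mainRep c = gRep c • xm`, `gRep c` unitary). -/
theorem hform_mainRep (K : X.Level) (xm : X.Tuple) (c : X.MainClass K xm) (i j : Fin 4) :
    hform X.c X.H (X.mainRep K xm c i) (X.mainRep K xm c j) = hform X.c X.H (xm i) (xm j) :=
  X.hform_unitary (X.gRep_isUnitaryOf K xm c) (xm i) (xm j)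

/-- The good-split bracket at a main-class representative is a non-negative real, under the unit conditions at `w` for the
centre `xm` and the face identity `ε_w(ϖ_w) = 1`. -/
theorem goodBracket_mainRep_nonneg (w : IsDedekindDomain.HeightOneSpectrum (NumberField.RingOfIntegers X.E))
    (hH : ∀ i j, w.valuation X.E (X.H i j) ≤ 1) (u : Fin 4 → ℂ) (hε : u 0 * u 1 * conj (u 2) * conj (u 3) = 1) (vol : ℝ)
    (K : X.Level) (xm : X.Tuple)
    (hunit : w.valuation X.E (hform X.c X.H (xm 0) (xm 0)) = 1 ∧ w.valuation X.E (hform X.c X.H (xm 1) (xm 1)) = 1 ∧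
      w.valuation X.E (hform X.c X.H (xm 0) (xm 1)) = 1 ∧ w.valuation X.E (hform X.c X.H (xm 1) (xm 0)) = 1)
    (c : X.MainClass K xm) :
    (X.goodBracket w u vol (X.mainRep K xm c)).im = 0 ∧ 0 ≤ (X.goodBracket w u vol (X.mainRep K xm c)).re := by
  unfold goodBracket
  refine GoodSplit.bracket_nonneg (w.valuation X.E) X.c X.H hH u hε vol ?_ ?_ ?_ ?_
  · rw [X.hform_mainRep K xm c 0 0]; exact hunit.1
  · rw [X.hform_mainRep K xm c 1 1]; exact hunit.2.1
  · rw [X.hform_mainRep K xm c 0 1]; exact hunit.2.2.1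
  · rw [X.hform_mainRep K xm c 1 0]; exact hunit.2.2.2

/-- The bad-place bracket at a main-class representative is a non-negative real under `BadConditions`. -/
theorem badBracket_mainRep_nonneg {D : X.ThetaData} {p : IsDedekindDomain.HeightOneSpectrum (NumberField.RingOfIntegers X.E)}
    {L₀ : Submodule (NumberField.RingOfIntegers X.E) (Fin 3 → X.E)} {xm : X.Tuple} {ℓ : X.LocS D p L₀ xm}
    (F : X.LocalFactorisation D p L₀ xm ℓ) (w : IsDedekindDomain.HeightOneSpectrum (NumberField.RingOfIntegers X.E))
    (hw : F.BadConditions w) (K : X.Level) (c : X.MainClass K xm) :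
    (X.badBracket w (F.μ w) (F.n w) xm (X.mainRep K xm c) (F.vol w)).im = 0 ∧
      0 ≤ (X.badBracket w (F.μ w) (F.n w) xm (X.mainRep K xm c) (F.vol w)).re := by
  obtain ⟨hH, ha, hb, i₀, j₀, ma, mb, e, hia, hjb, hman, hmbn, hab, hcond_a, hcond_b, hcond_13, hε⟩ := hw
  unfold badBracket
  refine BadPlace.bracket_nonneg_of_valuation (w.valuation X.E) X.c X.H hH (F.μ w) (F.vol w) ha hb hia hjb hman hmbn hab
    hcond_a hcond_b hcond_13 hε ?_
  rw [BadPlace.pairSplit_ι, X.hform_mainRep K xm c 0 1]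

/-- **TERMWISE POSITIVITY FROM THE DISPLAYED FACTORISATION** — the clause `LocPS.pos` of the skeleton: from some depth on, the
localised coefficient is a non-negative real at every main class.  Inputs: the factorisation `F`, the face identity at the
good split places (`hε_good`), the conditions `BadConditions` at the bad places. -/
theorem pos_of_localFactorisation (D : X.ThetaData)
    {p : IsDedekindDomain.HeightOneSpectrum (NumberField.RingOfIntegers X.E)}
    {L₀ : Submodule (NumberField.RingOfIntegers X.E) (Fin 3 → X.E)} {xm : X.Tuple} (ℓ : X.LocS D p L₀ xm)
    (F : X.LocalFactorisation D p L₀ xm ℓ)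
    (hε_good : ∀ w ∉ F.bad, F.u w 0 * F.u w 1 * conj (F.u w 2) * conj (F.u w 3) = 1)
    (hbad : ∀ w ∈ F.bad, F.BadConditions w) :
    ∃ N₀ : ℕ, ∀ N, N₀ ≤ N → ∀ c : X.MainClass (ℓ.level N) xm,
      (X.coefQ D.cf (ℓ.loc N) (X.mainRep (ℓ.level N) xm c)).im = 0 ∧
        0 ≤ (X.coefQ D.cf (ℓ.loc N) (X.mainRep (ℓ.level N) xm c)).re := by
  refine ⟨F.N₀, fun N hN c => ?_⟩
  obtain ⟨A, T, hA, hfac⟩ := F.factor N hN c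
  rw [hfac]
  have hprod := prod_im_eq_zero_re_nonneg T
    (fun w => if w ∈ F.bad then X.badBracket w (F.μ w) (F.n w) xm (X.mainRep (ℓ.level N) xm c) (F.vol w)
      else X.goodBracket w (F.u w) (F.vol w) (X.mainRep (ℓ.level N) xm c)) (fun w _ => by
        by_cases hw : w ∈ F.bad
        · simp only [hw, if_true]
          exact X.badBracket_mainRep_nonneg F w (hbad w hw) (ℓ.level N) c
        · simp only [hw, if_false]
          exact X.goodBracket_mainRep_nonneg w (F.good_integral w hw) (F.u w) (hε_good w hw) (F.vol w) (ℓ.level N) xm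
            (F.good_unit w hw) c)
  constructor
  · rw [Complex.mul_im, Complex.ofReal_re, Complex.ofReal_im, hprod.1]
    ring
  · rw [Complex.mul_re, Complex.ofReal_re, Complex.ofReal_im]
    simp only [zero_mul, sub_zero]
    exact mul_nonneg hA hprod.2

/-! ### The conditions packaged as ONE Prop on the structure (t4-plan-3 g2, S13086 (1)), so that the skeleton states one
hypothesis `hfac : ∀ p L₀ xm (ℓ : X.LocS D p L₀ xm), ∃ F : X.LocalFactorisation D p L₀ xm ℓ, F.FaceIdentity` and builds
`LocPS` from `pos_of_faceIdentity` by name. -/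

namespace LocalFactorisation

variable {X} {D : X.ThetaData} {p : IsDedekindDomain.HeightOneSpectrum (NumberField.RingOfIntegers X.E)}
  {L₀ : Submodule (NumberField.RingOfIntegers X.E) (Fin 3 → X.E)} {xm : X.Tuple} {ℓ : X.LocS D p L₀ xm}

/-- **THE FACE IDENTITY, with the bad-place conditions** — the one Prop beyond the factorisation data: `ε_w(ϖ_w) = 1` at every
good split place, and `BadConditions` (conductor clauses + `ε ≡ 1` on the torus) at every bad place.  This is exactly where
O-L3-7 lives: it is FALSE on the twisted members. -/
def FaceIdentity (F : X.LocalFactorisation D p L₀ xm ℓ) : Prop :=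
  (∀ w ∉ F.bad, F.u w 0 * F.u w 1 * conj (F.u w 2) * conj (F.u w 3) = 1) ∧ ∀ w ∈ F.bad, F.BadConditions w

end LocalFactorisation

/-- **TERMWISE POSITIVITY FROM A FACTORISATION WITH THE FACE IDENTITY** — `LocPS.pos` verbatim, one hypothesis. -/
theorem pos_of_faceIdentity (D : X.ThetaData)
    {p : IsDedekindDomain.HeightOneSpectrum (NumberField.RingOfIntegers X.E)}
    {L₀ : Submodule (NumberField.RingOfIntegers X.E) (Fin 3 → X.E)} {xm : X.Tuple} (ℓ : X.LocS D p L₀ xm)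
    (F : X.LocalFactorisation D p L₀ xm ℓ) (hF : F.FaceIdentity) :
    ∃ N₀ : ℕ, ∀ N, N₀ ≤ N → ∀ c : X.MainClass (ℓ.level N) xm,
      (X.coefQ D.cf (ℓ.loc N) (X.mainRep (ℓ.level N) xm c)).im = 0 ∧
        0 ≤ (X.coefQ D.cf (ℓ.loc N) (X.mainRep (ℓ.level N) xm c)).re :=
  X.pos_of_localFactorisation D ℓ F hF.1 hF.2

end T4Data

end Summit.Ventures.HodgeRepro.Tier4.Line3

end
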